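/-
Origin: expansion seat `planner-pub-hodgecm-pv06-g3-0`, handover #10 v2 2026-08-18T07:41:23Z (`HOME/pub-hodgecm-pv06-g3/lean/Pv06g3/ProductLattice.lean`, md5 f52afa6f, 199 lines);
landed by the gen-7 packager in gate run 26 as `HodgeCM/PerL34/ProductLattice.lean` (verbatim).
-/
/-
Origin: HOME/pub-hodgecm-pv06-g3/lean/Pv06g3/ProductLattice.lean — session planner-pub-hodgecm-pv06-g3-0
(unit pub-hodgecm-pv06-g3, DAG-NODE PROVER #06 gen 3; lineage N23c, PerL v5 l. 315 / Prop 3.6 Step 2).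
Intended final place (packager's call): `HodgeCM/PerL34/ProductLattice.lean`.
NEW, ADDITIVE LEAF; Mathlib-only imports.
KIND: KERNEL — complete proofs, no new axioms, nothing cited, nothing posited.
-/
import Mathlib.Topology.Algebra.Group.Quotient
import Mathlib.Topology.Algebra.Group.Basic
import Mathlib.Topology.Maps.OpenQuotient
import Mathlib.Topology.Algebra.IsUniformGroup.Basic
import Mathlib.Topology.Algebra.ContinuousMonoidHom

/-!
# Products of cocompact lattices

The torus of PerL v5 Prop. 3.6 is `T := U(W₁) × U(W₂)` (tex l. 315: "maximal tori of `U(W)` each canonically isomorphic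
to `U(1)²`"), so `T(𝔸) = U(1)(𝔸) × U(1)(𝔸)` and `T(L₀) = U(1)(L₀) × U(1)(L₀)`.  The single factor — the norm-one idele
torus `U(1)(𝔸) ⊇ U(1)(L₀)`: locally compact, `U(1)(L₀)` discrete and countable, `[U(1)]` compact, a fundamental domain —
is pv11-g4's `NormOneRelTorus*` / pv09-g4's `IdelicTorusDomain`.  This file supplies the generic facts, absent from
Mathlib, that transport the lattice hypotheses of `CompactTorusModelData` (`HodgeCM/PerL34/CompactTorusModel.lean`)
from the factors to a binary product:

* `Subgroup.countable_prod` : `Countable H → Countable K → Countable (H.prod K)`;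
* `Subgroup.discreteTopology_prod` : `DiscreteTopology H → DiscreteTopology K → DiscreteTopology (H.prod K)`;
* `QuotientGroup.quotientProdMap H K : (G ⧸ H) × (N ⧸ K) → (G × N) ⧸ H.prod K`, the canonical map, continuous
  (through `IsOpenQuotientMap.prodMap` of the two open quotient maps `QuotientGroup.mk`) and surjective;
* `QuotientGroup.compactSpace_quotient_prod` : `CompactSpace (G ⧸ H) → CompactSpace (N ⧸ K) →
  CompactSpace ((G × N) ⧸ H.prod K)`.

§2 records, as `example`s found by instance search, that for `T := A × A`, `Λ := Λ₀.prod Λ₀` every lattice-type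
hypothesis of the compact torus model then holds as soon as it holds for `(A, Λ₀)`: `Countable Λ`, `IsClosed Λ`
(`Subgroup.isClosed_of_discrete`), `CompactSpace (T ⧸ Λ)`, `LocallyCompactSpace T`, `DiscreteTopology Λ` (the
hypotheses of pv09-g4's `DiscreteFD.exists_isFundamentalDomain_op_finite'`, which then yields `exists_fd`).
-/

set_option autoImplicit false

/-! ## §1  Generic facts -/

namespace Subgroup

variable {G N : Type*} [Group G] [Group N]

/-- A product of countable subgroups is countable. -/
instance countable_prod (H : Subgroup G) (K : Subgroup N) [Countable H] [Countable K] :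
    Countable (H.prod K) :=
  Countable.of_equiv (H × K) (H.prodEquiv K).toEquiv.symm

variable [TopologicalSpace G] [TopologicalSpace N]

/-- A product of discrete subgroups is discrete. -/
instance discreteTopology_prod (H : Subgroup G) (K : Subgroup N) [DiscreteTopology H]
    [DiscreteTopology K] : DiscreteTopology (H.prod K) :=
  DiscreteTopology.of_continuous_injective
    (f := fun x : H.prod K => ((⟨x.1.1, (Subgroup.mem_prod.mp x.2).1⟩ : H), (⟨x.1.2, (Subgroup.mem_prod.mp x.2).2⟩ : K)))
    (((continuous_fst.comp continuous_subtype_val).subtype_mk _).prodMk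
      ((continuous_snd.comp continuous_subtype_val).subtype_mk _))
    (fun x y hxy => by
      simp only [Prod.mk.injEq, Subtype.mk.injEq] at hxy
      exact Subtype.ext (Prod.ext hxy.1 hxy.2))

end Subgroup

namespace QuotientGroup

variable {G N : Type*} [Group G] [Group N] (H : Subgroup G) (K : Subgroup N)

/-- **The canonical map `(G ⧸ H) × (N ⧸ K) → (G × N) ⧸ (H × K)`**, `(gH, nK) ↦ (g, n)(H × K)`. -/
def quotientProdMap : (G ⧸ H) × (N ⧸ K) → (G × N) ⧸ H.prod K := fun p =>
  Quotient.liftOn₂' p.1 p.2 (fun g n => (QuotientGroup.mk (g, n) : (G × N) ⧸ H.prod K)) (fun a₁ b₁ a₂ b₂ ha hb => by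
    rw [QuotientGroup.leftRel_apply] at ha hb
    show (QuotientGroup.mk (a₁, b₁) : (G × N) ⧸ H.prod K) = QuotientGroup.mk (a₂, b₂)
    rw [QuotientGroup.eq]
    exact Subgroup.mem_prod.mpr ⟨ha, hb⟩)

/-- (Ported verbatim from the HodgeCMPerL package; no docstring in the source.) -/
@[simp]
theorem quotientProdMap_mk (g : G) (n : N) :
    quotientProdMap H K ((g : G ⧸ H), (n : N ⧸ K)) = ((g, n) : (G × N) ⧸ H.prod K) := rfl

/-- (Ported verbatim from the HodgeCMPerL package; no docstring in the source.) -/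
theorem quotientProdMap_comp_prodMap :
    quotientProdMap H K ∘ Prod.map (QuotientGroup.mk : G → G ⧸ H) (QuotientGroup.mk : N → N ⧸ K) =
      (QuotientGroup.mk : G × N → (G × N) ⧸ H.prod K) := by
  rfl

/-- (Ported verbatim from the HodgeCMPerL package; no docstring in the source.) -/
theorem surjective_quotientProdMap : Function.Surjective (quotientProdMap H K) := by
  intro x
  obtain ⟨⟨g, n⟩, rfl⟩ := QuotientGroup.mk_surjective x
  exact ⟨((g : G ⧸ H), (n : N ⧸ K)), rfl⟩

/-- The inverse map `(G × N) ⧸ (H × K) → G ⧸ H × N ⧸ K`, `(g, n)(H × K) ↦ (gH, nK)`. -/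
def quotientProdInv : (G × N) ⧸ H.prod K → (G ⧸ H) × (N ⧸ K) := fun x =>
  Quotient.liftOn' x (fun p : G × N => ((p.1 : G ⧸ H), (p.2 : N ⧸ K))) (fun a b hab => by
    rw [QuotientGroup.leftRel_apply, Subgroup.mem_prod] at hab
    exact Prod.ext (QuotientGroup.eq.mpr hab.1) (QuotientGroup.eq.mpr hab.2))

/-- (Ported verbatim from the HodgeCMPerL package; no docstring in the source.) -/
@[simp]
theorem quotientProdInv_mk (g : G) (n : N) :
    quotientProdInv H K ((g, n) : (G × N) ⧸ H.prod K) = ((g : G ⧸ H), (n : N ⧸ K)) := rfl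

variable [TopologicalSpace G] [TopologicalSpace N]

/-- (Ported verbatim from the HodgeCMPerL package; no docstring in the source.) -/
theorem continuous_quotientProdInv : Continuous (quotientProdInv H K) :=
  (continuous_quotient_mk'.prodMap continuous_quotient_mk').quotient_liftOn' _

variable [ContinuousMul G] [ContinuousMul N]

/-- `quotientProdMap` is continuous: `mk × mk` is an open quotient map and the composite is `mk`. -/
theorem continuous_quotientProdMap : Continuous (quotientProdMap H K) := by
  have h : IsOpenQuotientMap (Prod.map (QuotientGroup.mk : G → G ⧸ H) (QuotientGroup.mk : N → N ⧸ K)) :=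
    QuotientGroup.isOpenQuotientMap_mk.prodMap QuotientGroup.isOpenQuotientMap_mk
  rw [← h.continuous_comp_iff, quotientProdMap_comp_prodMap]
  exact continuous_quotient_mk'

/-- **`G ⧸ H × N ⧸ K ≃ₜ (G × N) ⧸ (H × K)`.** -/
def quotientProdHomeomorph : (G ⧸ H) × (N ⧸ K) ≃ₜ (G × N) ⧸ H.prod K where
  toFun := quotientProdMap H K
  invFun := quotientProdInv H K
  left_inv := by
    rintro ⟨a, b⟩
    obtain ⟨g, rfl⟩ := QuotientGroup.mk_surjective a
    obtain ⟨n, rfl⟩ := QuotientGroup.mk_surjective b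
    rfl
  right_inv := by
    intro x
    obtain ⟨⟨g, n⟩, rfl⟩ := QuotientGroup.mk_surjective x
    rfl
  continuous_toFun := continuous_quotientProdMap H K
  continuous_invFun := continuous_quotientProdInv H K

/-- (Ported verbatim from the HodgeCMPerL package; no docstring in the source.) -/
@[simp]
theorem quotientProdHomeomorph_apply_mk (g : G) (n : N) :
    quotientProdHomeomorph H K ((g : G ⧸ H), (n : N ⧸ K)) = ((g, n) : (G × N) ⧸ H.prod K) := rfl

section Normal

variable [H.Normal] [K.Normal]

/-- For normal subgroups the canonical map is a group isomorphism … -/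
def quotientProdMulEquiv : (G ⧸ H) × (N ⧸ K) ≃* (G × N) ⧸ H.prod K :=
  { (quotientProdHomeomorph H K).toEquiv with
    map_mul' := by
      rintro ⟨a₁, b₁⟩ ⟨a₂, b₂⟩
      obtain ⟨g₁, rfl⟩ := QuotientGroup.mk_surjective a₁
      obtain ⟨n₁, rfl⟩ := QuotientGroup.mk_surjective b₁
      obtain ⟨g₂, rfl⟩ := QuotientGroup.mk_surjective a₂
      obtain ⟨n₂, rfl⟩ := QuotientGroup.mk_surjective b₂
      rfl }

/-- (Ported verbatim from the HodgeCMPerL package; no docstring in the source.) -/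
@[simp]
theorem quotientProdMulEquiv_apply_mk (g : G) (n : N) :
    quotientProdMulEquiv H K ((g : G ⧸ H), (n : N ⧸ K)) = ((g, n) : (G × N) ⧸ H.prod K) := rfl

/-- … and a topological one: **`G ⧸ H × N ⧸ K ≃ₜ* (G × N) ⧸ (H × K)`** (e.g. `[T] ≃ₜ* [U(W₁)] × [U(W₂)]` for the
torus `T = U(W₁) × U(W₂)` of PerL v5 l. 315, all groups commutative). -/
def quotientProdContinuousMulEquiv : (G ⧸ H) × (N ⧸ K) ≃ₜ* (G × N) ⧸ H.prod K :=
  { quotientProdMulEquiv H K with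
    continuous_toFun := continuous_quotientProdMap H K
    continuous_invFun := continuous_quotientProdInv H K }

/-- (Ported verbatim from the HodgeCMPerL package; no docstring in the source.) -/
@[simp]
theorem quotientProdContinuousMulEquiv_apply_mk (g : G) (n : N) :
    quotientProdContinuousMulEquiv H K ((g : G ⧸ H), (n : N ⧸ K)) = ((g, n) : (G × N) ⧸ H.prod K) := rfl

end Normal

/-- **A product of cocompact subgroups is cocompact.** -/
instance compactSpace_quotient_prod [CompactSpace (G ⧸ H)] [CompactSpace (N ⧸ K)] :
    CompactSpace ((G × N) ⧸ H.prod K) :=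
  (quotientProdHomeomorph H K).compactSpace

end QuotientGroup

/-! ## §2  The lattice hypotheses of the compact torus model for `T = A × A` -/

namespace HodgeCM
namespace PerL34
namespace ProductLattice

section TorusSquare

-- `A` = the norm-one idele torus `U(1)(𝔸)`, `Λ₀ = U(1)(L₀)` (pv11-g4 `relNormOneIdeles ⊇ relNormOneRat`).
variable (A : Type*) [CommGroup A] [TopologicalSpace A] [IsTopologicalGroup A] [LocallyCompactSpace A] [T2Space A]
  (Λ₀ : Subgroup A) [DiscreteTopology Λ₀] [Countable Λ₀] [CompactSpace (A ⧸ Λ₀)]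

example : CommGroup (A × A) := inferInstance
example : IsTopologicalGroup (A × A) := inferInstance
example : LocallyCompactSpace (A × A) := inferInstance
example : T2Space (A × A) := inferInstance
example : DiscreteTopology (Λ₀.prod Λ₀) := inferInstance
example : Countable (Λ₀.prod Λ₀) := inferInstance
example : IsClosed ((Λ₀.prod Λ₀ : Subgroup (A × A)) : Set (A × A)) := Subgroup.isClosed_of_discrete
example : CompactSpace ((A × A) ⧸ Λ₀.prod Λ₀) := inferInstance

end TorusSquare

end ProductLattice
end PerL34
end HodgeCM
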